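import Summits.KontsevichZagierPeriods.KontsevichZagierPeriods.Theses.LiftingCriteria
import Literature.NumberTheory.Transcendental.KZVolumeConjectureProofs
import Literature.NumberTheory.Transcendental.KZSemiCanonicalReductionProofs
import Literature.NumberTheory.Transcendental.KZLogCalculusProofs
import Literature.NumberTheory.Transcendental.KZCalculusProofs
import Literature.NumberTheory.Transcendental.SemialgebraicAlgebraicPoints

/-!
# `CubeNashNormalForm` (stmt-KontsevichZagierPeriods-3574): reduction to volumes of bounded sets

Support file for the item `CubeNashNormalForm` of route `LiftingCriteria`
(`Summit.KontsevichZagierPeriods.KontsevichZagierPeriods.Theses.LiftingCriteria.CubeNashNormalForm`):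
*every difference `[r] − [r']` of KZ-rational integral representations is, modulo the relations of
the Kontsevich–Zagier calculus, a `ℤ`-combination of CUBE–NASH representations* (domain the closed
unit cube `[0,1]ⁿ`, integrand a `ℚ`-semialgebraic function analytic on a neighbourhood of the cube).

What is proved here, unconditionally, over the calculus of `Literature/…/KZCalculus.lean`:

* §1 For ANY subgroup `N ≤ FormalRep` containing the relations and all cube–Nash generators:
  every representation of dimension `0` lies in `N` (`of_mem_of_dim_zero`); every representation of
  dimension `1` with integrand `1` lies in `N` (`of_mem_of_dim_one`: ground the domain to an
  interval `(0, L)`, `L` algebraic, then one Newton–Leibniz move down to the point `[pt, L]`); and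
  IF every BOUNDED integrand-`1` representation of dimension `≥ 2` lies in `N`, then EVERY
  representation lies in `N` (`of_mem_of_forall_volume`, by the tree's resolution-free
  `KZ.exists_sub_isBounded`: `[r] ≡ [A] − [B]` with `A`, `B` bounded volumes one dimension up).
* §2 The subgroup `relations ⊔ closure(cube–Nash generators)`: membership is exactly the existence
  of the normal form asked by the item (`exists_normalForm_of_mem_sup`).
* §3 Consequences for the item: `CubeNashNormalForm` follows from the cube–Nash normal form of
  VOLUMES OF BOUNDED `ℚ`-SEMIALGEBRAIC SETS of dimension `≥ 2` (`cubeNashNormalForm_of_volume`),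
  and the item's conclusion holds outright for representations of dimension `0`
  (`cubeNashNormalForm_dim_zero`).

What is NOT here: the cube–Nash normal form of bounded volumes in dimension `m ≥ 2` (`m = 2`:
Newton–Puiseux at the end points of the cells; `m ≥ 3`: local uniformization / embedded resolution
of singularities over `ℝ`, Hironaka 1964, Bierstone–Milman 1988 §4 — neither is in the tree).
-/

noncomputable section

open MeasureTheory Set Filter Topology
open scoped ENNReal
open Literature.ModelTheory.ExponentialFields (IsSemialgebraic isSemialgebraic_univ
  bandOver bandLower bandUpper bandLower_of_ne_zero bandUpper_of_ne_last mem_bandOver_iff)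
open Literature.NumberTheory.Transcendental
open Literature.NumberTheory.Transcendental.KZ

namespace Summit.KontsevichZagierPeriods.LiftingCriteria.CubeNashNormalFormReduction

/-! ## §1 Subgroups containing the relations and the cube–Nash generators -/

section Subgroup

variable (N : AddSubgroup FormalRep)

/-- **Dimension `0`.** If `N` contains the relations and every cube–Nash generator, then `[r] ∈ N`
for every representation `r` of dimension `0`: either its domain is empty (a null domain is a
relation) or it is the whole one-point space `ℝ⁰ = [0,1]⁰`, on which the integrand is constant, hence
analytic, and `ℚ`-semialgebraic — a cube–Nash generator. [folklore] -/
theorem of_mem_of_dim_zero (hrel : relations ≤ N)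
    (hgen : ∀ {m : ℕ} (t : IntegralRep m) (g : (Fin m → ℝ) → ℝ) (U : Set (Fin m → ℝ)),
      IsOpen U → Set.pi Set.univ (fun _ : Fin m => Set.Icc (0:ℝ) 1) ⊆ U →
      IsSemialgebraicFunOn ℚ U g → AnalyticOnNhd ℝ g U →
      t.domain = Set.pi Set.univ (fun _ : Fin m => Set.Icc (0:ℝ) 1) →
      (∀ z ∈ Set.pi Set.univ (fun _ : Fin m => Set.Icc (0:ℝ) 1), t.integrand z = g z) → of t ∈ N)
    (r : IntegralRep 0) : of r ∈ N := by
  rcases r.domain.eq_empty_or_nonempty with h | h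
  · exact hrel (of_mem_relations_of_volume_eq_zero r (by rw [h, measure_empty]))
  · obtain ⟨y, hy⟩ := h
    have hdom : r.domain = univ := eq_univ_of_forall fun x => by rwa [Subsingleton.elim x y]
    have hcube : Set.pi Set.univ (fun _ : Fin 0 => Set.Icc (0:ℝ) 1) = univ :=
      eq_univ_of_forall fun x => Set.mem_univ_pi.mpr fun i => i.elim0
    refine hgen r r.integrand univ isOpen_univ (subset_univ _) ?_ ?_ (hdom.trans hcube.symm)
      (fun _ _ => rfl)
    · simpa [hdom] using r.isSemialgebraicFunOn_integrand
    · have : r.integrand = fun _ => r.integrand y := funext fun x => by rw [Subsingleton.elim x y]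
      rw [this]
      exact analyticOnNhd_const

/-- The length `L > 0` of a `ℚ`-semialgebraic interval `{z | 0 < z₀ < L} ⊆ ℝ¹` is algebraic over `ℚ`:
at the end point the interval is neither a neighbourhood nor a co-neighbourhood
(`isAlgebraic_of_not_mem_nhds`). [folklore] -/
theorem isAlgebraic_of_isSemialgebraic_interval {L : ℝ} (hL : 0 < L) {T : Set (Fin (0 + 1) → ℝ)}
    (hT : IsSemialgebraic ℚ T) (hmem : ∀ v, v ∈ T ↔ 0 < v (Fin.last 0) ∧ v (Fin.last 0) < L) :
    IsAlgebraic ℚ L := by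
  set x : Fin (0 + 1) → ℝ := fun _ => L with hx
  have h := isAlgebraic_of_not_mem_nhds (x := x) hT (fun h => ?_) (fun h => ?_)
  · simpa [hx] using h
  · have := (hmem x).1 (mem_of_mem_nhds h)
    simp [hx] at this
  · obtain ⟨ε, hε, hball⟩ := Metric.mem_nhds_iff.mp h
    set δ : ℝ := min (ε / 2) (L / 2) with hδ
    have hδpos : 0 < δ := lt_min (by linarith) (by linarith)
    have hδε : δ < ε := (min_le_left _ _).trans_lt (by linarith)
    have hδL : δ < L := (min_le_right _ _).trans_lt (by linarith)
    set z : Fin (0 + 1) → ℝ := fun _ => L - δ with hz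
    have hzball : z ∈ Metric.ball x ε := by
      rw [Metric.mem_ball, dist_pi_lt_iff hε]
      intro b
      rw [hz, hx, Real.dist_eq, show L - δ - L = -δ by ring, abs_neg, abs_of_pos hδpos]
      exact hδε
    have hzT : z ∈ T := (hmem z).2 ⟨by simp [hz]; linarith, by simp [hz]; linarith⟩
    exact hball hzball hzT

/-- **Dimension `1`, integrand `1`.** If `N` contains the relations and every cube–Nash generator,
then `[K] ∈ N` for every representation `K = ∫_S 1` of dimension `1`: ground `S` to the interval
`T = (0, L)`, `L = vol S` (`KZ.of_sub_of_mem_relations_groundLast`, a chain of moves); if `L = 0`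
the domain is null; otherwise `L` is algebraic (`isAlgebraic_of_isSemialgebraic_interval`), the
closed band `[0, L]` over the point differs from `T` by two null end points, and one Newton–Leibniz
move (`KZ.exists_band_sub_base_mem_newtonLeibnizRel`, primitive `t`) goes down to the
zero-dimensional representation `[pt, L]`, which lies in `N` by `of_mem_of_dim_zero`.
[Kontsevich–Zagier 2001, §1.2, rules (1), (3)] [folklore] -/
theorem of_mem_of_dim_one (hrel : relations ≤ N)
    (hgen : ∀ {m : ℕ} (t : IntegralRep m) (g : (Fin m → ℝ) → ℝ) (U : Set (Fin m → ℝ)),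
      IsOpen U → Set.pi Set.univ (fun _ : Fin m => Set.Icc (0:ℝ) 1) ⊆ U →
      IsSemialgebraicFunOn ℚ U g → AnalyticOnNhd ℝ g U →
      t.domain = Set.pi Set.univ (fun _ : Fin m => Set.Icc (0:ℝ) 1) →
      (∀ z ∈ Set.pi Set.univ (fun _ : Fin m => Set.Icc (0:ℝ) 1), t.integrand z = g z) → of t ∈ N)
    (K : IntegralRep (0 + 1)) (h1 : ∀ x ∈ K.domain, K.integrand x = 1) : of K ∈ N := by
  have hS : IsSemialgebraic ℚ K.domain := K.isSemialgebraic_domain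
  have hSm : MeasurableSet K.domain := IntegralRep.measurableSet_domain_holds K
  have hfin : volume K.domain ≠ ⊤ := volume_ne_top_of_integrand_one K h1
  -- the fibre of `S` over the point of `ℝ⁰` and its length `V = vol S`
  set p : Fin 0 → ℝ := fun i => i.elim0 with hp
  set V : ℝ≥0∞ := volume (FibreLength.fibre K.domain p) with hV
  have hinit : ∀ v : Fin (0 + 1) → ℝ, Fin.init v = p := fun v => Subsingleton.elim _ _
  have hVS : volume K.domain = V := by
    rw [Grounding.volume_eq_lintegral_fibre hSm,
      lintegral_congr (g := fun _ => V) fun β => by rw [Subsingleton.elim β p], lintegral_const,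
      MeasureTheory.volume_pi, Measure.pi_univ]
    simp
  -- the null case
  rcases eq_or_ne V 0 with hV0 | hV0
  · exact hrel (of_mem_relations_of_volume_eq_zero K (hVS.trans hV0))
  have hVtop : V ≠ ⊤ := hVS ▸ hfin
  set L : ℝ := V.toReal with hL
  have hLpos : 0 < L := ENNReal.toReal_pos hV0 hVtop
  -- ground: `T = (0, L)` over the point
  set T : Set (Fin (0 + 1) → ℝ) := Grounding.groundLast K.domain with hT
  have hTsa : IsSemialgebraic ℚ T := Grounding.isSemialgebraic_groundLast hS
  have hTm : MeasurableSet T := IsSemialgebraic.measurableSet_holds hTsa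
  have hTvol : volume T = volume K.domain := Grounding.volume_groundLast hSm hTm
  have hTmem : ∀ v, v ∈ T ↔ 0 < v (Fin.last 0) ∧ v (Fin.last 0) < L := fun v => by
    rw [hT, Grounding.mem_groundLast_iff, hinit, ← hV, hL]
    constructor
    · rintro ⟨h0, h⟩
      exact ⟨h0, (ENNReal.ofReal_lt_iff_lt_toReal h0.le hVtop).1 h⟩
    · rintro ⟨h0, h⟩
      exact ⟨h0, (ENNReal.ofReal_lt_iff_lt_toReal h0.le hVtop).2 h⟩
  obtain ⟨r', hr'd, hr'i⟩ := exists_oneRep hTsa (by rw [hTvol]; exact hfin)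
  have e1 : of K - of r' ∈ relations :=
    of_sub_of_mem_relations_groundLast K r' h1 hr'd fun x _ => by rw [hr'i]
  -- `L` is algebraic, so the constant sections `0 < L` over the point are `ℚ`-semialgebraic
  have hLalg : IsAlgebraic ℚ L := isAlgebraic_of_isSemialgebraic_interval hLpos hTsa hTmem
  set ξ : Fin 2 → (Fin 0 → ℝ) → ℝ := ![fun _ => (0:ℝ), fun _ => L] with hξ
  have hξ0 : ξ 0 = fun _ => (0:ℝ) := rfl
  have hξ1 : ξ 1 = fun _ => L := rfl
  have hξsa : ∀ i, IsSemialgebraicFunOn ℚ (univ : Set (Fin 0 → ℝ)) (ξ i) := fun i => by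
    fin_cases i
    · simpa [hξ0] using isSemialgebraicFunOn_const_of_isAlgebraic isSemialgebraic_univ isAlgebraic_zero
    · simpa [hξ1] using isSemialgebraicFunOn_const_of_isAlgebraic isSemialgebraic_univ hLalg
  have hmono : ∀ x ∈ (univ : Set (Fin 0 → ℝ)), StrictMono fun i => ξ i x := fun x _ => by
    refine Fin.strictMono_iff_lt_succ.2 fun i => ?_
    fin_cases i
    simpa [hξ0, hξ1] using hLpos
  have h10 : (1 : Fin 3) ≠ 0 := by decide
  have h1l : (1 : Fin 3) ≠ Fin.last 2 := by decide
  have hlo : ∀ x, bandLower ξ 1 x = ((0:ℝ) : EReal) := fun x => by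
    rw [bandLower_of_ne_zero ξ 1 h10]; rfl
  have hhi : ∀ x, bandUpper ξ 1 x = ((L:ℝ) : EReal) := fun x => by
    rw [bandUpper_of_ne_last ξ 1 h1l]; rfl
  have hband : ∀ v, v ∈ bandOver univ ξ 1 ↔ v ∈ T := fun v => by
    rw [mem_bandOver_iff, hlo, hhi, EReal.coe_lt_coe_iff, EReal.coe_lt_coe_iff, hTmem]
    simp
  have hsub : bandOver univ ξ 1 ⊆ T := fun v hv => (hband v).1 hv
  obtain ⟨Bd, b, hBdd, hBdi, hbd, hbi, hNL⟩ :=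
    exists_band_sub_base_mem_newtonLeibnizRel (S := T) (by rw [hTvol]; exact hfin) isSemialgebraic_univ
      ξ hξsa hmono h10 h1l hsub
  -- `T` and the closed band differ by the two null end points
  have e2 : of r' - of Bd ∈ relations := by
    refine of_sub_of_mem_relations_of_null r' Bd ?_ ?_ fun z _ => by rw [hr'i, hBdi]
    · rw [hr'd, hBdd, show T \ KZlog.band univ (fun x => (bandLower ξ 1 x).toReal)
          (fun x => (bandUpper ξ 1 x).toReal) = ∅ from sdiff_eq_empty.mpr fun v hv => ?_, measure_empty]
      rw [KZlog.mem_band, hlo, hhi, EReal.toReal_coe, EReal.toReal_coe]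
      rw [hTmem] at hv
      exact ⟨mem_univ _, hv.1.le, hv.2.le⟩
    · have hg0 := volume_graph_eq_zero (hξsa 0)
      have hg1 := volume_graph_eq_zero (hξsa 1)
      rw [hξ0] at hg0
      rw [hξ1] at hg1
      refine measure_mono_null (fun v hv => ?_) (measure_union_null hg0 hg1)
      rw [hBdd, hr'd] at hv
      obtain ⟨hv, hv'⟩ := hv
      rw [KZlog.mem_band, hlo, hhi, EReal.toReal_coe, EReal.toReal_coe] at hv
      obtain ⟨-, h0, hL'⟩ := hv
      rw [hTmem] at hv'
      rcases h0.lt_or_eq with h0 | h0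
      · rcases hL'.lt_or_eq with hL' | hL'
        · exact absurd ⟨h0, hL'⟩ hv'
        · exact Or.inr ⟨mem_univ _, hL'⟩
      · exact Or.inl ⟨mem_univ _, h0.symm⟩
  have e3 : of Bd - of b ∈ relations := newtonLeibnizRel_subset_relations hNL
  have hb : of b ∈ N := of_mem_of_dim_zero N hrel hgen b
  have : of K = (of K - of r') + (of r' - of Bd) + (of Bd - of b) + of b := by abel
  rw [this]
  exact N.add_mem (N.add_mem (N.add_mem (hrel e1) (hrel e2)) (hrel e3)) hb

/-- **All representations from bounded volumes of dimension `≥ 2`.** If `N` contains the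
relations, every cube–Nash generator, and `[K]` for every representation `K = ∫_D 1` of dimension
`m + 2` with BOUNDED domain, then `[r] ∈ N` for every representation `r` of every dimension: by the
tree's resolution-free form of Viu-Sos' reduction (`KZ.exists_sub_isBounded`: sign splitting, region
under the graph, grounding and monomial compression) `[r] ≡ [A] − [B]` with `A`, `B` bounded
volumes one dimension up, which lie in `N` by hypothesis (dimension `≥ 2`) or by
`of_mem_of_dim_one` (dimension `1`). [Viu-Sos 2021, Thm. 1.1 / Cor. 2.3, as discharged in the tree]
[folklore] -/
theorem of_mem_of_forall_volume (hrel : relations ≤ N)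
    (hgen : ∀ {m : ℕ} (t : IntegralRep m) (g : (Fin m → ℝ) → ℝ) (U : Set (Fin m → ℝ)),
      IsOpen U → Set.pi Set.univ (fun _ : Fin m => Set.Icc (0:ℝ) 1) ⊆ U →
      IsSemialgebraicFunOn ℚ U g → AnalyticOnNhd ℝ g U →
      t.domain = Set.pi Set.univ (fun _ : Fin m => Set.Icc (0:ℝ) 1) →
      (∀ z ∈ Set.pi Set.univ (fun _ : Fin m => Set.Icc (0:ℝ) 1), t.integrand z = g z) → of t ∈ N)
    (hvol : ∀ (m : ℕ) (K : IntegralRep (m + 2)), Bornology.IsBounded K.domain →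
      (∀ x ∈ K.domain, K.integrand x = 1) → of K ∈ N)
    {k : ℕ} (r : IntegralRep k) : of r ∈ N := by
  obtain ⟨A, B, hAb, hBb, hA1, hB1, e⟩ := exists_sub_isBounded r
  have hvol' : ∀ K : IntegralRep (k + 1), Bornology.IsBounded K.domain →
      (∀ x ∈ K.domain, K.integrand x = 1) → of K ∈ N := by
    intro K hKb hK1
    cases k with
    | zero => exact of_mem_of_dim_one N hrel hgen K hK1
    | succ k => exact hvol k K hKb hK1
  have : of r = (of r - (of A - of B)) + of A - of B := by abel
  rw [this]
  exact N.sub_mem (N.add_mem (hrel e) (hvol' A hAb hA1)) (hvol' B hBb hB1)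

end Subgroup

/-! ## §2 The subgroup generated by the relations and the cube–Nash representations -/

/-- **Extraction of the normal form.** If `c ∈ relations ⊔ closure {[t] | t cube–Nash}` then `c`
has the normal form asked by the item: finitely many cube–Nash representations `s i` (with their
open neighbourhoods `U i` and Nash extensions `g i`) and integers `ε i` with
`c − ∑ ε i • [s i] ∈ relations`. (`AddSubgroup.mem_sup`, and `closure = ℤ-span`,
`Submodule.mem_span_set'`, which enumerates a finite combination by `Fin S`.) [folklore] -/
theorem exists_normalForm_of_mem_sup {c : FormalRep}
    (hc : c ∈ relations ⊔ AddSubgroup.closure {x : FormalRep | ∃ (m : ℕ) (t : IntegralRep m)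
      (g : (Fin m → ℝ) → ℝ) (U : Set (Fin m → ℝ)), IsOpen U ∧
      Set.pi Set.univ (fun _ : Fin m => Set.Icc (0:ℝ) 1) ⊆ U ∧ IsSemialgebraicFunOn ℚ U g ∧
      AnalyticOnNhd ℝ g U ∧ t.domain = Set.pi Set.univ (fun _ : Fin m => Set.Icc (0:ℝ) 1) ∧
      (∀ z ∈ Set.pi Set.univ (fun _ : Fin m => Set.Icc (0:ℝ) 1), t.integrand z = g z) ∧ x = of t}) :
    ∃ (S : ℕ) (n : Fin S → ℕ) (g : (i : Fin S) → (Fin (n i) → ℝ) → ℝ)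
      (U : (i : Fin S) → Set (Fin (n i) → ℝ)) (ε : Fin S → ℤ) (s : (i : Fin S) → IntegralRep (n i)),
      (∀ i, IsOpen (U i) ∧ Set.pi Set.univ (fun _ : Fin (n i) => Set.Icc (0:ℝ) 1) ⊆ (U i) ∧
        IsSemialgebraicFunOn ℚ (U i) (g i) ∧ AnalyticOnNhd ℝ (g i) (U i)) ∧
      (∀ i, (s i).domain = Set.pi Set.univ (fun _ : Fin (n i) => Set.Icc (0:ℝ) 1) ∧
        ∀ z ∈ Set.pi Set.univ (fun _ : Fin (n i) => Set.Icc (0:ℝ) 1), (s i).integrand z = g i z) ∧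
      c - ∑ i, ε i • of (s i) ∈ relations := by
  obtain ⟨y, hy, z, hz, rfl⟩ := AddSubgroup.mem_sup.mp hc
  rw [← Submodule.span_int_eq_addSubgroupClosure, Submodule.mem_toAddSubgroup,
    Submodule.mem_span_set'] at hz
  obtain ⟨S, f, x, hx⟩ := hz
  have hG : ∀ i : Fin S, ∃ (m : ℕ) (t : IntegralRep m) (g : (Fin m → ℝ) → ℝ) (U : Set (Fin m → ℝ)),
      IsOpen U ∧ Set.pi Set.univ (fun _ : Fin m => Set.Icc (0:ℝ) 1) ⊆ U ∧ IsSemialgebraicFunOn ℚ U g ∧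
      AnalyticOnNhd ℝ g U ∧ t.domain = Set.pi Set.univ (fun _ : Fin m => Set.Icc (0:ℝ) 1) ∧
      (∀ z ∈ Set.pi Set.univ (fun _ : Fin m => Set.Icc (0:ℝ) 1), t.integrand z = g z) ∧
      (x i : FormalRep) = of t := fun i => (x i).2
  choose n t g U hopen hsub hsa han hdom hint heq using hG
  refine ⟨S, n, g, U, f, t, fun i => ⟨hopen i, hsub i, hsa i, han i⟩, fun i => ⟨hdom i, hint i⟩, ?_⟩
  have hsum : ∑ i, f i • of (t i) = ∑ i, f i • (x i : FormalRep) :=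
    Finset.sum_congr rfl fun i _ => by rw [heq i]
  rw [hsum, hx, add_sub_cancel_right]
  exact hy

/-- **Normal form from membership in every admissible subgroup.** If `c` lies in every subgroup
of `FormalRep` containing the relations and the cube–Nash generators, then `c` has the normal form
asked by the item (apply to `relations ⊔ closure {[t] | t cube–Nash}` and extract). [folklore] -/
theorem exists_normalForm_of_forall_mem {c : FormalRep}
    (h : ∀ N : AddSubgroup FormalRep, relations ≤ N →
      (∀ {m : ℕ} (t : IntegralRep m) (g : (Fin m → ℝ) → ℝ) (U : Set (Fin m → ℝ)),
        IsOpen U → Set.pi Set.univ (fun _ : Fin m => Set.Icc (0:ℝ) 1) ⊆ U →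
        IsSemialgebraicFunOn ℚ U g → AnalyticOnNhd ℝ g U →
        t.domain = Set.pi Set.univ (fun _ : Fin m => Set.Icc (0:ℝ) 1) →
        (∀ z ∈ Set.pi Set.univ (fun _ : Fin m => Set.Icc (0:ℝ) 1), t.integrand z = g z) → of t ∈ N) →
      c ∈ N) :
    ∃ (S : ℕ) (n : Fin S → ℕ) (g : (i : Fin S) → (Fin (n i) → ℝ) → ℝ)
      (U : (i : Fin S) → Set (Fin (n i) → ℝ)) (ε : Fin S → ℤ) (s : (i : Fin S) → IntegralRep (n i)),
      (∀ i, IsOpen (U i) ∧ Set.pi Set.univ (fun _ : Fin (n i) => Set.Icc (0:ℝ) 1) ⊆ (U i) ∧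
        IsSemialgebraicFunOn ℚ (U i) (g i) ∧ AnalyticOnNhd ℝ (g i) (U i)) ∧
      (∀ i, (s i).domain = Set.pi Set.univ (fun _ : Fin (n i) => Set.Icc (0:ℝ) 1) ∧
        ∀ z ∈ Set.pi Set.univ (fun _ : Fin (n i) => Set.Icc (0:ℝ) 1), (s i).integrand z = g i z) ∧
      c - ∑ i, ε i • of (s i) ∈ relations :=
  exists_normalForm_of_mem_sup (h _ le_sup_left fun t g U h1 h2 h3 h4 h5 h6 =>
    AddSubgroup.mem_sup_right (AddSubgroup.subset_closure ⟨_, t, g, U, h1, h2, h3, h4, h5, h6, rfl⟩))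

/-! ## §3 Consequences for the item `CubeNashNormalForm` -/

/-- **`CubeNashNormalForm` from the cube–Nash normal form of bounded volumes.** If every
representation `∫_D 1` of dimension `m + 2` on a BOUNDED `ℚ`-semialgebraic domain `D` is, modulo
relations, a `ℤ`-combination of cube–Nash representations, then so is every difference `[r] − [r']`
of KZ-rational representations (indeed of any two representations): this is the resolution-type
step missing from the tree (embedded resolution of singularities / local uniformization over `ℝ`)
isolated as the one hypothesis, everything else being moves already discharged in the tree.
[Viu-Sos 2021, Thm. 1.1 (tree discharge `KZ.exists_sub_isBounded`); Kontsevich–Zagier 2001, §1.2]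
[folklore] -/
theorem cubeNashNormalForm_of_volume
    (H : ∀ (m : ℕ) (K : IntegralRep (m + 2)), Bornology.IsBounded K.domain →
      (∀ x ∈ K.domain, K.integrand x = 1) →
      ∃ (S : ℕ) (n : Fin S → ℕ) (g : (i : Fin S) → (Fin (n i) → ℝ) → ℝ)
        (U : (i : Fin S) → Set (Fin (n i) → ℝ)) (ε : Fin S → ℤ) (s : (i : Fin S) → IntegralRep (n i)),
        (∀ i, IsOpen (U i) ∧ Set.pi Set.univ (fun _ : Fin (n i) => Set.Icc (0:ℝ) 1) ⊆ (U i) ∧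
          IsSemialgebraicFunOn ℚ (U i) (g i) ∧ AnalyticOnNhd ℝ (g i) (U i)) ∧
        (∀ i, (s i).domain = Set.pi Set.univ (fun _ : Fin (n i) => Set.Icc (0:ℝ) 1) ∧
          ∀ z ∈ Set.pi Set.univ (fun _ : Fin (n i) => Set.Icc (0:ℝ) 1), (s i).integrand z = g i z) ∧
        of K - ∑ i, ε i • of (s i) ∈ relations) :
    Summit.KontsevichZagierPeriods.KontsevichZagierPeriods.Theses.LiftingCriteria.CubeNashNormalForm := by
  intro k k' r r' _ _
  refine exists_normalForm_of_forall_mem fun N hrel hgen => ?_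
  have hvol : ∀ (m : ℕ) (K : IntegralRep (m + 2)), Bornology.IsBounded K.domain →
      (∀ x ∈ K.domain, K.integrand x = 1) → of K ∈ N := fun m K hb hK1 => by
    obtain ⟨S, n, g, U, ε, s, hg, hs, e⟩ := H m K hb hK1
    have hsum : ∑ i, ε i • of (s i) ∈ N := N.sum_mem fun i _ => N.zsmul_mem
      (hgen (s i) (g i) (U i) (hg i).1 (hg i).2.1 (hg i).2.2.1 (hg i).2.2.2 (hs i).1 (hs i).2) _
    have : of K = (of K - ∑ i, ε i • of (s i)) + ∑ i, ε i • of (s i) := by abel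
    rw [this]
    exact N.add_mem (hrel e) hsum
  exact N.sub_mem (of_mem_of_forall_volume N hrel hgen hvol r)
    (of_mem_of_forall_volume N hrel hgen hvol r')

/-- **The item's conclusion in dimension `0`, unconditionally**: for representations `r`, `r'` of
dimension `0` (rational or not) `[r] − [r']` is, modulo relations, a `ℤ`-combination of cube–Nash
representations. [folklore] -/
theorem cubeNashNormalForm_dim_zero (r r' : IntegralRep 0) :
    ∃ (S : ℕ) (n : Fin S → ℕ) (g : (i : Fin S) → (Fin (n i) → ℝ) → ℝ)
      (U : (i : Fin S) → Set (Fin (n i) → ℝ)) (ε : Fin S → ℤ) (s : (i : Fin S) → IntegralRep (n i)),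
      (∀ i, IsOpen (U i) ∧ Set.pi Set.univ (fun _ : Fin (n i) => Set.Icc (0:ℝ) 1) ⊆ (U i) ∧
        IsSemialgebraicFunOn ℚ (U i) (g i) ∧ AnalyticOnNhd ℝ (g i) (U i)) ∧
      (∀ i, (s i).domain = Set.pi Set.univ (fun _ : Fin (n i) => Set.Icc (0:ℝ) 1) ∧
        ∀ z ∈ Set.pi Set.univ (fun _ : Fin (n i) => Set.Icc (0:ℝ) 1), (s i).integrand z = g i z) ∧
      of r - of r' - ∑ i, ε i • of (s i) ∈ relations :=
  exists_normalForm_of_forall_mem fun N hrel hgen =>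
    N.sub_mem (of_mem_of_dim_zero N hrel hgen r) (of_mem_of_dim_zero N hrel hgen r')

/-- **Volumes of one-dimensional sets have the normal form, unconditionally**: for a
representation `K = ∫_S 1` of dimension `1`, `[K]` is, modulo relations, a `ℤ`-combination of
cube–Nash representations (of dimension `0`: the lengths of the intervals of `S`). [folklore] -/
theorem volumeNormalForm_dim_one (K : IntegralRep 1) (h1 : ∀ x ∈ K.domain, K.integrand x = 1) :
    ∃ (S : ℕ) (n : Fin S → ℕ) (g : (i : Fin S) → (Fin (n i) → ℝ) → ℝ)
      (U : (i : Fin S) → Set (Fin (n i) → ℝ)) (ε : Fin S → ℤ) (s : (i : Fin S) → IntegralRep (n i)),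
      (∀ i, IsOpen (U i) ∧ Set.pi Set.univ (fun _ : Fin (n i) => Set.Icc (0:ℝ) 1) ⊆ (U i) ∧
        IsSemialgebraicFunOn ℚ (U i) (g i) ∧ AnalyticOnNhd ℝ (g i) (U i)) ∧
      (∀ i, (s i).domain = Set.pi Set.univ (fun _ : Fin (n i) => Set.Icc (0:ℝ) 1) ∧
        ∀ z ∈ Set.pi Set.univ (fun _ : Fin (n i) => Set.Icc (0:ℝ) 1), (s i).integrand z = g i z) ∧
      of K - ∑ i, ε i • of (s i) ∈ relations :=
  exists_normalForm_of_forall_mem fun N hrel hgen => of_mem_of_dim_one N hrel hgen K h1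

end Summit.KontsevichZagierPeriods.LiftingCriteria.CubeNashNormalFormReduction
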